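import Literature.MathematicalPhysics.QuantumFieldTheory.Balaban1983to89.B9SupplySockB9P3ZdAllLettersZd
import Literature.MathematicalPhysics.QuantumFieldTheory.Balaban1983to89.B9SupplySockB9P3ZdAtHerm

/-!
# `Balaban1983to89.B9Eq327GreenZdHerm` — [Balaban1985BackgroundPropagators] (3.27) `G(U₀) = (Ω₀Δ_aΩ₀)⁻¹` ON THE HERMITIAN SUB-CARRIER `E_𝔤(Ω₀)` (print's
# `𝔤`-valued fields, p. 391, (3.21) «L²(Ω₀, 𝔤)»): the sub-carrier `domSubH`, the qualitative Theorem-3.11 predicate `RegularAtH`, the propagator letter `gopZdH`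
# AS AN OBJECT, the record edit `withGopZdH`, EDITION H's binder `InvAtH` PROVED from `RegularInClassAtH` alone, and — finite `Ω₀` — positivity of
# `⟨A, Δ_a(U₀)A⟩_τ` on `E_𝔤(Ω₀) ∖ 0` (`PosDefInClassAtH`) ⟹ `RegularAtH` ⟹ `InvAtH` — the H-twin of dag-n06-w4's `B9Eq327GreenZd` ∕ `…GenuineGop` §4

statement-level skeleton of published theorems with citation tags; proofs where landed; nothing here is a claim about the
Yang–Mills mass gap

`[Balaban1985BackgroundPropagators]` ("B9", CMP **99** (1985) 389–434) p. 391 *«values in N × N hermitian matrices»*, (3.21) p. 394 *«L²(Ω₀, 𝔤)»*, (3.26)–(3.27)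
p. 395 *«G(U) = G = (Δ_a↾Ω₀)⁻¹»*, Thm 3.11 p. 416; `[Balaban1985RegularSpaces]` ("B8") (1.58) p. 86, Prop. 3 p. 87 (`A′` Hermitian).

CITATION HEADER (lean-in-tree rule).  Cell `pub-ymgap` (YM Track A, HUMAN RULING D-0062 ∕ D-0149), node N06 = [B9]; seat `pub-ymgap-dag-n06-b` (g18), binder owner
of the junction J-N06→N05.  WHY: this seat's certificate `B9SupplySockB9P3ZdSkewGaugeMode` (p601330) shows that on the `𝔸`-valued carrier `domSub` the genuine
`Δ_a(1)` has skew-Hermitian zero modes, so w4's `RegularAt ∕ gopZd ∕ PosDefInClassAt` (`B9Eq327GreenZd`, `…GenuineGop`) and the binder `InvAt` are unsatisfiable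
at `m ≥ 1` members; the cure is print's own setting — the Hermitian sub-carrier.  EDITION H of the binder (`B9SupplySockB9P3ZdAtHerm.InvAtH`, p601378) is
landed; dag-n06-w4 g2 closed (bus 03:35Z) without the object side; this seat's word (bus 03:26Z: «silence by 04:00Z ⇒ I type it as `Lit/B9Eq327GreenZdHerm.lean`
with your names») is kept here — `B9Eq327GreenZd` itself is imported BY NAME and not restated; every construction is its H-twin on the sub-module `domSubH ≤ domSub`.

WHAT IS DECLARED ∕ PROVED (kernel, 0 sorry; definitions with bodies + theorems; no `instance`, no `notation`).
* §1 `hermPart a := ½(a + a*)` · `hermPart_of_isSelfAdjoint` · `isSelfAdjoint_hermPart` · `hermPart_add ∕ _smul ∕ _zero`.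
* §2 ★ `domSubH Ω₀` (`E_𝔤(Ω₀)` as a real subspace: `A ∈ domSub Ω₀` with Hermitian values) · `mem_domSubH_iff` · `domSubH_le` · `mem_domSubH_of_onDom` (the binders'
  `OnDom` + the socket's Hermitian clause) · `finiteDimensional_domSubH` · `restrictLinH` (`𝟙_{Ω₀}` followed by the Hermitian part, a linear map INTO `E_𝔤(Ω₀)`) ·
  `restrictLinH_coe_of_herm` (= `𝟙_{Ω₀}` on fields Hermitian on the bonds of `Ω₀`).
* §3 ★ `RegularAtH η o Ω₀ U₀` (Prop: `Δ_a(U₀)↾Ω₀` agrees on `E_𝔤(Ω₀)` with an invertible ℝ-linear operator of `E_𝔤(Ω₀)`) · `deltaAEquivH ∕ _coe` · ★ `gopZdH`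
  (`G_𝔤(U₀) := (Δ_a↾E_𝔤(Ω₀))⁻¹ ∘ hermPart ∘ 𝟙_{Ω₀}`, total; `0` off the regime) · `gopZdH_of_regularAtH ∕ _of_not_regularAtH ∕ _add ∕ _mem_domSubH` ·
  ★★ `gopZdH_apply_eq_of_regularAtH` ((3.27) as (1.58) uses it: `G_𝔤(U₀)J = A` for Hermitian `A ∈ E(Ω₀)` and ANY `J` agreeing with `Δ_a(U₀)A` on the bonds of `Ω₀`).
* §4 `withGopZdH ops` · `withGopZdH_Gop` · `deltaAOf_withGopZdH` (rfl) · `gopAddAt_withGopZdH` (no hypothesis) · `RegularInClassAtH` (Prop) ·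
  ★★★ `invAtH_withGopZdH` (`RegularInClassAtH → InvAtH bg L mem ιCfg (withGopZdH ops) c35 a₃ M i m`).
* §5 `HermPreservingAt` (Prop: `Δ_a(U₀)` maps `E_𝔤(Ω₀)` to Hermitian values on the bonds of `Ω₀`) · ★★ `regularAtH_of_bondPair_pos` (finite `Ω₀`: `LinearOnDomAt` +
  `HermPreservingAt` + positivity on `E_𝔤(Ω₀) ∖ 0` ⟹ `RegularAtH`) · `PosDefInClassAtH` (Prop: Thm 3.11 in print's currency, Hermitian fields) · `LinHermInClassAt` ·
  ★★ `regularInClassAtH_of_posDefH` · ★★★ `invAtH_withGopZdH_of_posDefH`.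

HONEST SCOPE.  (i) Objects + bookkeeping; Theorem 3.11 is NOT proved: `RegularInClassAtH ∕ PosDefInClassAtH` are DISPLAYED `Prop`s whose content is print's
Thm 3.11 at the member; the per-member road (dag-n06-w2 IDEA-3.11, corrected: (i)_𝔤 flat positivity on `E_𝔤(Ω₀)` AT A CLASS WITH LEVEL-0 CROSSING BONDS, (ii)
continuity, (iii) gauge covariance) is what would inhabit `PosDefInClassAtH`; `HermPreservingAt ∕ LinearOnDomAt` for the four-letter record `opsAllZd` are NOT
proved here (for `D*D` and `D R 𝟙 D*` they follow from w4's star lemmas ∕ `projE_apply_isSelfAdjoint`; for `Δ′(U₀)` and `Q*aQ` from the symmetry of those letters —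
successor items).  (ii) No A6 witness beyond w4's: at truncation `m = 0` the landed `InvAt` witnesses give `InvAtH` by `invAtH_of_invAt`; `RegularAtH` at `U₀ = 1`
is (i)_𝔤.  (iii) Count-neutral; N05 ∕ N06 NOT discharged; K1⁷ `stmt-QuantumFields-20542` NOT closed; 28∕28 · 5∕27 UNMOVED; one finite `𝕋⁴` programme at fixed `ε`,
Bałaban as printed; nothing continuum ∕ ℝ⁴ ∕ OS ∕ mass gap ∕ Clay — R4 closes the conditional finite-`𝕋⁴` rung `BalabanLadder.UV` only.  Unit `pub-ymgap-dag-n06-b`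
(g18), 2026-08-28.
-/

noncomputable section

namespace Literature.MathematicalPhysics.QuantumFieldTheory.Balaban1983to89.B9Eq327GreenZdHerm

open B7Prop1Explicit
open B7Prop2Explicit (unitaryUnits)
open B8Ineq132 (BondTouches)
open B8LeafModelZd (ZdIdx)
open B9SupplySockB9P3ZdLetters (OpsZd deltaAOf)
open B9SupplySockB9P3ZdLettersOmega (OnDom restrictDom restrictDom_of restrictDom_of_not)
open B9SupplySockB9P3ZdAt (GopAddAt)
open B9SupplySockB9P3ZdAtHerm (InvAtH)
open B9Eq327GreenZd (domSub deltaADom bondPair bondPair_zero_right bondPair_restrictDom_right LinearOnDomAt finiteDimensional_domSub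
  restrictDom_mem_domSub mem_domSub_of_onDom)

export B7Prop1Explicit (Site)

variable {d : ℕ} {𝔸 : Type*} [CStarAlgebra 𝔸]

/-! ## §1 The Hermitian part in the fibre -/

section Herm

/-- **THE HERMITIAN PART `½(a + a*)`** (print's fields take values in `𝔤` = Hermitian matrices, p. 391). [cite: Balaban1985BackgroundPropagators, p.391 («values in N × N hermitian matrices»)] -/
def hermPart (a : 𝔸) : 𝔸 := (2 : ℝ)⁻¹ • (a + star a)

/-- the Hermitian part of a Hermitian element is itself. [cite: Balaban1985BackgroundPropagators, p.391] -/
theorem hermPart_of_isSelfAdjoint {a : 𝔸} (h : IsSelfAdjoint a) : hermPart a = a := by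
  rw [hermPart, h.star_eq, ← two_smul ℝ a, smul_smul, inv_mul_cancel₀ (two_ne_zero), one_smul]

/-- the Hermitian part is Hermitian. [cite: Balaban1985BackgroundPropagators, p.391] -/
theorem isSelfAdjoint_hermPart (a : 𝔸) : IsSelfAdjoint (hermPart a) := by
  rw [IsSelfAdjoint, hermPart, star_smul, star_trivial, star_add, star_star, add_comm]

/-- additivity. [cite: Balaban1985BackgroundPropagators, p.391 (bookkeeping)] -/
theorem hermPart_add (a b : 𝔸) : hermPart (a + b) = hermPart a + hermPart b := by
  simp only [hermPart, star_add, smul_add]; abel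

/-- real homogeneity. [cite: Balaban1985BackgroundPropagators, p.391 (bookkeeping)] -/
theorem hermPart_smul (r : ℝ) (a : 𝔸) : hermPart (r • a) = r • hermPart a := by
  simp only [hermPart, star_smul, star_trivial, ← smul_add, smul_comm r]

/-- `hermPart 0 = 0`. [cite: Balaban1985BackgroundPropagators, p.391 (bookkeeping)] -/
theorem hermPart_zero : hermPart (0 : 𝔸) = 0 := by simp [hermPart]

end Herm

/-! ## §2 The Hermitian sub-carrier `E_𝔤(Ω₀)` -/

section Carrier

variable (Ω₀ : Set (Site d))

/-- ★ **`E_𝔤(Ω₀)`, THE HERMITIAN SUB-CARRIER**: bond fields supported on the bonds of `Ω₀` with Hermitian values (print's `𝔤`-valued configurations on `Ω₀`,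
[B9] p. 391, (3.21) «L²(Ω₀, 𝔤)»), as a real subspace of all bond fields. [cite: Balaban1985BackgroundPropagators, p.391, (3.21) p.394, (3.27) p.395] -/
def domSubH : Submodule ℝ (Site d → Fin d → 𝔸) where
  carrier := {A | A ∈ domSub (𝔸 := 𝔸) Ω₀ ∧ ∀ (y : Site d) (τ : Fin d), IsSelfAdjoint (A y τ)}
  add_mem' := by
    rintro A B ⟨hA, hA'⟩ ⟨hB, hB'⟩
    exact ⟨(domSub Ω₀).add_mem hA hB, fun y τ => (hA' y τ).add (hB' y τ)⟩
  zero_mem' := ⟨(domSub Ω₀).zero_mem, fun _ _ => IsSelfAdjoint.zero _⟩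
  smul_mem' := by
    rintro c A ⟨hA, hA'⟩
    refine ⟨(domSub Ω₀).smul_mem c hA, fun y τ => ?_⟩
    rw [Pi.smul_apply, Pi.smul_apply, IsSelfAdjoint, star_smul, star_trivial, (hA' y τ).star_eq]

/-- membership, unfolded. [cite: Balaban1985BackgroundPropagators, (3.27) p.395 (bookkeeping)] -/
theorem mem_domSubH_iff (A : Site d → Fin d → 𝔸) :
    A ∈ domSubH (𝔸 := 𝔸) Ω₀ ↔ A ∈ domSub (𝔸 := 𝔸) Ω₀ ∧ ∀ (y : Site d) (τ : Fin d), IsSelfAdjoint (A y τ) := Iff.rfl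

/-- `E_𝔤(Ω₀) ≤ E(Ω₀)`. [cite: Balaban1985BackgroundPropagators, (3.27) p.395] -/
theorem domSubH_le : domSubH (𝔸 := 𝔸) Ω₀ ≤ domSub (𝔸 := 𝔸) Ω₀ := fun _ h => h.1

/-- a Hermitian `A ∈ E(Ω₀)` (the binders' `OnDom` + the socket's Hermitian clause) lies in `E_𝔤(Ω₀)`. [cite: Balaban1985BackgroundPropagators, (3.27) p.395; Balaban1985RegularSpaces, Prop. 3 p.87 (A′ Hermitian)] -/
theorem mem_domSubH_of_onDom {L m : ℕ} {η : ℝ} {Ω : ℕ → Set (Site d)} {A : Site d → Fin d → 𝔸} (hA : OnDom L m η Ω A)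
    (hsa : ∀ (y : Site d) (τ : Fin d), IsSelfAdjoint (A y τ)) : A ∈ domSubH (𝔸 := 𝔸) (Ω 0) :=
  ⟨mem_domSub_of_onDom hA, hsa⟩

/-- `E_𝔤(Ω₀)` is finite-dimensional for a finite `Ω₀` and a finite-dimensional fibre. [cite: Balaban1985BackgroundPropagators, (3.27) p.395] -/
theorem finiteDimensional_domSubH [FiniteDimensional ℝ 𝔸] {Ω₀ : Set (Site d)} (hΩ : Ω₀.Finite) :
    FiniteDimensional ℝ (domSubH (𝔸 := 𝔸) Ω₀) := by
  haveI := finiteDimensional_domSub (𝔸 := 𝔸) hΩ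
  exact Submodule.finiteDimensional_of_le (domSubH_le Ω₀)

open Classical in
/-- **`𝟙_{Ω₀}` FOLLOWED BY THE HERMITIAN PART**, as a linear map into `E_𝔤(Ω₀)` (on fields Hermitian on the bonds of `Ω₀` it is plain `𝟙_{Ω₀}`).
[cite: Balaban1985BackgroundPropagators, (3.27) p.395 («Ω₀ denotes also the characteristic function»), p.391] -/
def restrictLinH : (Site d → Fin d → 𝔸) →ₗ[ℝ] domSubH (𝔸 := 𝔸) Ω₀ where
  toFun J := ⟨fun y τ => if BondTouches Ω₀ y τ then hermPart (J y τ) else 0,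
    ⟨fun y τ h => by simp only [if_neg h], fun y τ => by
      by_cases h : BondTouches Ω₀ y τ
      · simp only [if_pos h]; exact isSelfAdjoint_hermPart _
      · simp only [if_neg h]; exact IsSelfAdjoint.zero _⟩⟩
  map_add' J₁ J₂ := by
    apply Subtype.ext; funext y τ
    simp only [Pi.add_apply, Submodule.coe_add]
    split_ifs
    · exact hermPart_add _ _
    · exact (add_zero _).symm
  map_smul' c J := by
    apply Subtype.ext; funext y τ
    simp only [Pi.smul_apply, RingHom.id_apply, Submodule.coe_smul]
    split_ifs
    · exact hermPart_smul _ _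
    · exact (smul_zero _).symm

open Classical in
/-- on a field Hermitian on the bonds of `Ω₀`, `restrictLinH` is `𝟙_{Ω₀}`. [cite: Balaban1985BackgroundPropagators, (3.27) p.395 (bookkeeping)] -/
theorem restrictLinH_coe_of_herm {J : Site d → Fin d → 𝔸} (hJ : ∀ (y : Site d) (τ : Fin d), BondTouches Ω₀ y τ → IsSelfAdjoint (J y τ)) :
    (restrictLinH (𝔸 := 𝔸) Ω₀ J : Site d → Fin d → 𝔸) = restrictDom Ω₀ J := by
  funext y τ
  show (if BondTouches Ω₀ y τ then hermPart (J y τ) else 0) = restrictDom Ω₀ J y τ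
  by_cases h : BondTouches Ω₀ y τ
  · rw [if_pos h, restrictDom_of J h, hermPart_of_isSelfAdjoint (hJ y τ h)]
  · rw [if_neg h, restrictDom_of_not J h]

end Carrier

/-! ## §3 Regularity and the propagator on the Hermitian sub-carrier -/

section Green

variable (η : ℝ) (o : OpsZd d 𝔸) (Ω₀ : Set (Site d)) (U₀ : Site d → Fin d → 𝔸ˣ)

/-- ★ **THEOREM 3.11's CONCLUSION ON `E_𝔤(Ω₀)`, qualitative**: «`Δ_a(U₀)↾Ω₀` agrees on `E_𝔤(Ω₀)` with an INVERTIBLE ℝ-linear operator of `E_𝔤(Ω₀)`» — a `Prop`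
(print: Thm 3.11 for `U₀` in the class (3.35)). [cite: Balaban1985BackgroundPropagators, Thm 3.11 p.416, (3.27) p.395, p.391] -/
def RegularAtH (η : ℝ) (o : OpsZd d 𝔸) (Ω₀ : Set (Site d)) (U₀ : Site d → Fin d → 𝔸ˣ) : Prop :=
  ∃ Φ : domSubH (𝔸 := 𝔸) Ω₀ →ₗ[ℝ] domSubH (𝔸 := 𝔸) Ω₀,
    (∀ A : domSubH (𝔸 := 𝔸) Ω₀, (Φ A : Site d → Fin d → 𝔸) = deltaADom η o Ω₀ U₀ A) ∧ Function.Bijective Φ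

/-- the invertible operator of `RegularAtH`. [cite: Balaban1985BackgroundPropagators, (3.27) p.395] -/
def deltaAEquivH (h : RegularAtH η o Ω₀ U₀) : domSubH (𝔸 := 𝔸) Ω₀ ≃ₗ[ℝ] domSubH (𝔸 := 𝔸) Ω₀ :=
  LinearEquiv.ofBijective (Classical.choose h) (Classical.choose_spec h).2

/-- the equivalence acts as `Δ_a↾Ω₀`. [cite: Balaban1985BackgroundPropagators, (3.27) p.395 (bookkeeping)] -/
theorem deltaAEquivH_coe (h : RegularAtH η o Ω₀ U₀) (A : domSubH (𝔸 := 𝔸) Ω₀) :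
    (deltaAEquivH η o Ω₀ U₀ h A : Site d → Fin d → 𝔸) = deltaADom η o Ω₀ U₀ A := by
  rw [deltaAEquivH, LinearEquiv.ofBijective_apply]
  exact (Classical.choose_spec h).1 A

open Classical in
/-- ★ **`G_𝔤(U₀) = (Ω₀Δ_aΩ₀)⁻¹` ON THE HERMITIAN SUB-CARRIER** ((3.27) in print's setting): on a bond field `J`, take the Hermitian part of `𝟙_{Ω₀}J` and apply
the inverse of `Δ_a(U₀)↾E_𝔤(Ω₀)` — when `RegularAtH`; `0` otherwise. [cite: Balaban1985BackgroundPropagators, (3.27) p.395, Thm 3.11 p.416, p.391] -/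
def gopZdH (J : Site d → Fin d → 𝔸) : Site d → Fin d → 𝔸 :=
  if h : RegularAtH η o Ω₀ U₀ then ((deltaAEquivH η o Ω₀ U₀ h).symm (restrictLinH Ω₀ J) : domSubH (𝔸 := 𝔸) Ω₀) else 0

/-- `G_𝔤` in the regime. [cite: Balaban1985BackgroundPropagators, (3.27) p.395 (bookkeeping)] -/
theorem gopZdH_of_regularAtH (h : RegularAtH η o Ω₀ U₀) (J : Site d → Fin d → 𝔸) :
    gopZdH η o Ω₀ U₀ J = ((deltaAEquivH η o Ω₀ U₀ h).symm (restrictLinH Ω₀ J) : domSubH (𝔸 := 𝔸) Ω₀) := by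
  rw [gopZdH, dif_pos h]

/-- `G_𝔤 = 0` outside the regime (no claim). [cite: Balaban1985BackgroundPropagators, (3.27) p.395 (bookkeeping)] -/
theorem gopZdH_of_not_regularAtH (h : ¬ RegularAtH η o Ω₀ U₀) (J : Site d → Fin d → 𝔸) : gopZdH η o Ω₀ U₀ J = 0 := by
  rw [gopZdH, dif_neg h]

/-- **`G_𝔤` IS ADDITIVE IN `J`, ALWAYS.** [cite: Balaban1985BackgroundPropagators, (3.27) p.395] -/
theorem gopZdH_add (J₁ J₂ : Site d → Fin d → 𝔸) : gopZdH η o Ω₀ U₀ (J₁ + J₂) = gopZdH η o Ω₀ U₀ J₁ + gopZdH η o Ω₀ U₀ J₂ := by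
  by_cases h : RegularAtH η o Ω₀ U₀
  · rw [gopZdH_of_regularAtH η o Ω₀ U₀ h, gopZdH_of_regularAtH η o Ω₀ U₀ h, gopZdH_of_regularAtH η o Ω₀ U₀ h, map_add, map_add,
      Submodule.coe_add]
  · rw [gopZdH_of_not_regularAtH η o Ω₀ U₀ h, gopZdH_of_not_regularAtH η o Ω₀ U₀ h, gopZdH_of_not_regularAtH η o Ω₀ U₀ h, add_zero]

/-- `G_𝔤 J ∈ E_𝔤(Ω₀)`. [cite: Balaban1985BackgroundPropagators, (3.27) p.395] -/
theorem gopZdH_mem_domSubH (J : Site d → Fin d → 𝔸) : gopZdH η o Ω₀ U₀ J ∈ domSubH (𝔸 := 𝔸) Ω₀ := by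
  by_cases h : RegularAtH η o Ω₀ U₀
  · rw [gopZdH_of_regularAtH η o Ω₀ U₀ h]; exact Submodule.coe_mem _
  · rw [gopZdH_of_not_regularAtH η o Ω₀ U₀ h]; exact Submodule.zero_mem _

/-- ★★ **(3.27) ON `E_𝔤(Ω₀)`: `G_𝔤(U₀)(Δ_a(U₀)A) = A`** — in the regime `RegularAtH`, for a Hermitian `A ∈ E(Ω₀)` and ANY bond field `J` agreeing with `Δ_a(U₀)A` on the
bonds of `Ω₀`. [cite: Balaban1985BackgroundPropagators, (3.27) p.395; Balaban1985RegularSpaces, (1.58) p.86] -/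
theorem gopZdH_apply_eq_of_regularAtH (h : RegularAtH η o Ω₀ U₀) {A : Site d → Fin d → 𝔸} (hA : A ∈ domSubH (𝔸 := 𝔸) Ω₀)
    {J : Site d → Fin d → 𝔸} (hJ : ∀ (y : Site d) (τ : Fin d), BondTouches Ω₀ y τ → J y τ = deltaAOf η o U₀ A y τ) :
    gopZdH η o Ω₀ U₀ J = A := by
  rw [gopZdH_of_regularAtH η o Ω₀ U₀ h]
  -- on the bonds of `Ω₀`, `J = Δ_aA = Φ⟨A⟩`, which is Hermitian-valued
  have hΦ := deltaAEquivH_coe η o Ω₀ U₀ h ⟨A, hA⟩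
  have hJherm : ∀ (y : Site d) (τ : Fin d), BondTouches Ω₀ y τ → IsSelfAdjoint (J y τ) := by
    intro y τ hb
    have hmem := (deltaAEquivH η o Ω₀ U₀ h ⟨A, hA⟩).2.2 y τ
    rw [hΦ, deltaADom, restrictDom_of _ hb, ← hJ y τ hb] at hmem
    exact hmem
  have hres : restrictLinH (𝔸 := 𝔸) Ω₀ J = deltaAEquivH η o Ω₀ U₀ h ⟨A, hA⟩ := by
    apply Subtype.ext
    rw [restrictLinH_coe_of_herm Ω₀ hJherm, hΦ]
    funext y τ
    by_cases hb : BondTouches Ω₀ y τ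
    · rw [restrictDom_of J hb, deltaADom, restrictDom_of _ hb, hJ y τ hb]
    · rw [restrictDom_of_not J hb, deltaADom, restrictDom_of_not _ hb]
  rw [hres, LinearEquiv.symm_apply_apply]

end Green

/-! ## §4 The record edit `withGopZdH`; `GopAddAt` (proved) and `InvAtH` (from `RegularInClassAtH`) -/

section Record

variable {L : ℕ}

/-- **THE LETTER FAMILY WITH `Gop := G_𝔤`** (the record's own co-letters untouched). [cite: Balaban1985BackgroundPropagators, (3.27) p.395] -/
def withGopZdH (ops : ℝ → ZdIdx d L → ℕ → OpsZd d 𝔸) : ℝ → ZdIdx d L → ℕ → OpsZd d 𝔸 :=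
  fun M i m => { ops M i m with Gop := gopZdH i.η (ops M i m) (i.Ω 0) }

variable (ops : ℝ → ZdIdx d L → ℕ → OpsZd d 𝔸) (M : ℝ) (i : ZdIdx d L) (m : ℕ)

/-- the replaced field. [cite: Balaban1985BackgroundPropagators, (3.27) p.395 (bookkeeping)] -/
theorem withGopZdH_Gop (U₀ : Site d → Fin d → 𝔸ˣ) (J : Site d → Fin d → 𝔸) :
    (withGopZdH ops M i m).Gop U₀ J = gopZdH i.η (ops M i m) (i.Ω 0) U₀ J := rfl

/-- the co-letters are untouched: `Δ_a` of the edited record is the record's. [cite: Balaban1985BackgroundPropagators, (3.26) p.395 (bookkeeping)] -/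
theorem deltaAOf_withGopZdH (U₀ : Site d → Fin d → 𝔸ˣ) (A : Site d → Fin d → 𝔸) :
    deltaAOf i.η (withGopZdH ops M i m) U₀ A = deltaAOf i.η (ops M i m) U₀ A := rfl

/-- **`GopAddAt` FOR `G_𝔤`, NO HYPOTHESIS.** [cite: Balaban1985BackgroundPropagators, (3.27) p.395] -/
theorem gopAddAt_withGopZdH : GopAddAt L (withGopZdH ops) M i m := by
  intro U₀ J₁ J₂
  exact gopZdH_add i.η (ops M i m) (i.Ω 0) U₀ J₁ J₂

variable {I : Type} (bg : I → B9.Backgrounds) (mem : ℝ → ZdIdx d L → ℕ → I)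
variable (ιCfg : ∀ (M : ℝ) (i : ZdIdx d L) (m : ℕ) (U₀ : Site d → Fin d → 𝔸ˣ),
  (∀ x κ, U₀ x κ ∈ unitaryUnits 𝔸) → (bg (mem M i m)).Cfg)

/-- **THEOREM 3.11 AT THE MEMBER ON `E_𝔤(Ω₀)`** (qualitative: `RegularAtH` at every unitary background of the member's class (3.35) with the guards of `InvAt`).
A `Prop`, NOT proved. [cite: Balaban1985BackgroundPropagators, Thm 3.11 p.416, (3.35) p.396, (3.27) p.395] -/
def RegularInClassAtH (ops : ℝ → ZdIdx d L → ℕ → OpsZd d 𝔸) (c35 a₃ : ℝ) (M : ℝ) (i : ZdIdx d L) (m : ℕ) : Prop :=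
  ∀ (α₀ : ℝ) (U₀ : Site d → Fin d → 𝔸ˣ) (hU₀ : ∀ x κ, U₀ x κ ∈ unitaryUnits 𝔸), 0 < α₀ → M * α₀ ≤ a₃ →
    (bg (mem M i m)).Reg335 c35 α₀ (ιCfg M i m U₀ hU₀) → RegularAtH i.η (ops M i m) (i.Ω 0) U₀

/-- ★★★ **EDITION H's BINDER `InvAtH` FOR `G_𝔤`, FROM THEOREM 3.11 ON `E_𝔤(Ω₀)` ALONE.** [cite: Balaban1985BackgroundPropagators, (3.27) p.395, Thm 3.11 p.416; Balaban1985RegularSpaces, (1.58) p.86] -/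
theorem invAtH_withGopZdH (c35 a₃ : ℝ) (hreg : RegularInClassAtH bg mem ιCfg ops c35 a₃ M i m) :
    InvAtH bg L mem ιCfg (withGopZdH ops) c35 a₃ M i m := by
  intro α₀ U₀ hU₀ hα hMα hR A hA hsa J hJ
  show gopZdH i.η (ops M i m) (i.Ω 0) U₀ J = A
  exact gopZdH_apply_eq_of_regularAtH i.η (ops M i m) (i.Ω 0) U₀ (hreg α₀ U₀ hU₀ hα hMα hR) (mem_domSubH_of_onDom hA hsa) hJ

end Record

/-! ## §5 Finite `Ω₀`: positivity of `⟨A, Δ_a(U₀)A⟩_τ` on `E_𝔤(Ω₀)` gives `RegularAtH` -/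

section Positivity

variable (τ : 𝔸 →ₗ[ℂ] ℂ)

/-- **«`Δ_a(U₀)` MAPS `E_𝔤(Ω₀)` INTO `𝔤`-VALUED FIELDS ON THE BONDS OF `Ω₀`»** — a `Prop` on the record's letters at `U₀` (true for print's operator at a unitary
background; for the genuine letters: `D*D`, `D R 𝟙 D*` preserve Hermiticity, `Δ′(U₀)`, `Q*aQ` by their symmetry — to be proved letter by letter).
[cite: Balaban1985BackgroundPropagators, (3.26) p.395, p.391 («hermitian matrices»)] -/
def HermPreservingAt (η : ℝ) (o : OpsZd d 𝔸) (Ω₀ : Set (Site d)) (U₀ : Site d → Fin d → 𝔸ˣ) : Prop :=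
  ∀ A ∈ domSubH (𝔸 := 𝔸) Ω₀, ∀ (y : Site d) (τ : Fin d), BondTouches Ω₀ y τ → IsSelfAdjoint (deltaAOf η o U₀ A y τ)

/-- ★★ **POSITIVITY ON `E_𝔤(Ω₀)` GIVES `RegularAtH`** (`Ω₀` finite, finite-dimensional fibre): if `Δ_a(U₀)` is the restriction of an ℝ-linear map on `E(Ω₀)`,
preserves Hermiticity on `E_𝔤(Ω₀)`, and `0 < ⟨A, Δ_a(U₀)A⟩_τ` for every `0 ≠ A ∈ E_𝔤(Ω₀)`, then `Δ_a(U₀)↾Ω₀` is an invertible operator of `E_𝔤(Ω₀)` —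
positive ⟹ injective ⟹ bijective. [cite: Balaban1985BackgroundPropagators, Thm 3.11 p.416, (3.27) p.395, p.391] -/
theorem regularAtH_of_bondPair_pos [FiniteDimensional ℝ 𝔸] {η : ℝ} {o : OpsZd d 𝔸} {Ω₀ : Set (Site d)} {U₀ : Site d → Fin d → 𝔸ˣ}
    (hΩ : Ω₀.Finite) (hlin : LinearOnDomAt η o Ω₀ U₀) (hherm : HermPreservingAt η o Ω₀ U₀)
    (hpos : ∀ A ∈ domSubH (𝔸 := 𝔸) Ω₀, A ≠ 0 → 0 < bondPair τ A (deltaAOf η o U₀ A)) :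
    RegularAtH η o Ω₀ U₀ := by
  classical
  haveI := finiteDimensional_domSubH (𝔸 := 𝔸) hΩ
  obtain ⟨T, hT⟩ := hlin
  -- `Φ := 𝟙_{Ω₀} ∘ T` restricted to `E_𝔤(Ω₀)`, with values in `E_𝔤(Ω₀)` by `hherm`
  have hval : ∀ A : domSubH (𝔸 := 𝔸) Ω₀, restrictDom Ω₀ (T A) ∈ domSubH (𝔸 := 𝔸) Ω₀ := by
    intro A
    refine ⟨restrictDom_mem_domSub Ω₀ _, fun y τ' => ?_⟩
    by_cases hb : BondTouches Ω₀ y τ'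
    · rw [restrictDom_of _ hb, hT A (domSubH_le Ω₀ A.2)]
      exact hherm A A.2 y τ' hb
    · rw [restrictDom_of_not _ hb]; exact IsSelfAdjoint.zero _
  let Φ : domSubH (𝔸 := 𝔸) Ω₀ →ₗ[ℝ] domSubH (𝔸 := 𝔸) Ω₀ :=
    { toFun := fun A => ⟨restrictDom Ω₀ (T A), hval A⟩
      map_add' := fun A B => by
        apply Subtype.ext
        simp only [Submodule.coe_add, map_add, B9Eq327GreenZd.restrictDom_add']
      map_smul' := fun c A => by
        apply Subtype.ext
        simp only [Submodule.coe_smul, map_smul, RingHom.id_apply, B9Eq327GreenZd.restrictDom_smul'] }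
  have hΦ : ∀ A : domSubH (𝔸 := 𝔸) Ω₀, (Φ A : Site d → Fin d → 𝔸) = deltaADom η o Ω₀ U₀ A := by
    intro A
    show restrictDom Ω₀ (T A) = restrictDom Ω₀ (deltaAOf η o U₀ A)
    rw [hT A (domSubH_le Ω₀ A.2)]
  have hinj : Function.Injective Φ := by
    intro A B hAB
    by_contra hne
    have hne' : ((A - B : domSubH (𝔸 := 𝔸) Ω₀) : Site d → Fin d → 𝔸) ≠ 0 := by
      intro h0
      exact hne (sub_eq_zero.1 (Subtype.ext h0))
    have hp := hpos _ (A - B).2 hne'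
    have hzero : (Φ (A - B) : Site d → Fin d → 𝔸) = 0 := by rw [map_sub, hAB, sub_self, Submodule.coe_zero]
    rw [← bondPair_restrictDom_right τ (domSubH_le Ω₀ (A - B).2), ← deltaADom, ← hΦ, hzero, bondPair_zero_right] at hp
    exact lt_irrefl _ hp
  exact ⟨Φ, hΦ, hinj, LinearMap.injective_iff_surjective.1 hinj⟩

variable {L : ℕ}
variable {I : Type} (bg : I → B9.Backgrounds) (mem : ℝ → ZdIdx d L → ℕ → I)
variable (ιCfg : ∀ (M : ℝ) (i : ZdIdx d L) (m : ℕ) (U₀ : Site d → Fin d → 𝔸ˣ),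
  (∀ x κ, U₀ x κ ∈ unitaryUnits 𝔸) → (bg (mem M i m)).Cfg)

/-- ★ **THEOREM 3.11 AT THE MEMBER IN PRINT'S CURRENCY, HERMITIAN FIELDS**: for every unitary `U₀` of the member's class with the guards of `InvAt` and every
`0 ≠ A ∈ E_𝔤(Ω₀)`, `0 < ⟨A, Δ_a(U₀)A⟩_τ` — a `Prop` (NOT proved; print's Thm 3.11). [cite: Balaban1985BackgroundPropagators, Thm 3.11 p.416, p.391] -/
def PosDefInClassAtH (ops : ℝ → ZdIdx d L → ℕ → OpsZd d 𝔸) (c35 a₃ : ℝ) (M : ℝ) (i : ZdIdx d L) (m : ℕ) : Prop :=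
  ∀ (α₀ : ℝ) (U₀ : Site d → Fin d → 𝔸ˣ) (hU₀ : ∀ x κ, U₀ x κ ∈ unitaryUnits 𝔸), 0 < α₀ → M * α₀ ≤ a₃ →
    (bg (mem M i m)).Reg335 c35 α₀ (ιCfg M i m U₀ hU₀) →
    ∀ A ∈ domSubH (𝔸 := 𝔸) (i.Ω 0), A ≠ 0 → 0 < bondPair τ A (deltaAOf i.η (ops M i m) U₀ A)

/-- the two structural hypotheses at the class, as `Prop`s. [cite: Balaban1985BackgroundPropagators, (3.26) p.395] -/
def LinHermInClassAt (ops : ℝ → ZdIdx d L → ℕ → OpsZd d 𝔸) (c35 a₃ : ℝ) (M : ℝ) (i : ZdIdx d L) (m : ℕ) : Prop :=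
  ∀ (α₀ : ℝ) (U₀ : Site d → Fin d → 𝔸ˣ) (hU₀ : ∀ x κ, U₀ x κ ∈ unitaryUnits 𝔸), 0 < α₀ → M * α₀ ≤ a₃ →
    (bg (mem M i m)).Reg335 c35 α₀ (ιCfg M i m U₀ hU₀) →
    LinearOnDomAt i.η (ops M i m) (i.Ω 0) U₀ ∧ HermPreservingAt i.η (ops M i m) (i.Ω 0) U₀

/-- ★★ **`PosDefInClassAtH` ⟹ `RegularInClassAtH`** (finite `Ω₀`; linearity + Hermiticity preservation at the class). [cite: Balaban1985BackgroundPropagators, Thm 3.11 p.416, (3.27) p.395] -/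
theorem regularInClassAtH_of_posDefH [FiniteDimensional ℝ 𝔸] (ops : ℝ → ZdIdx d L → ℕ → OpsZd d 𝔸) (c35 a₃ M : ℝ) (i : ZdIdx d L) (m : ℕ)
    (hΩ : (i.Ω 0).Finite) (hstr : LinHermInClassAt bg mem ιCfg ops c35 a₃ M i m)
    (hpos : PosDefInClassAtH τ bg mem ιCfg ops c35 a₃ M i m) :
    RegularInClassAtH bg mem ιCfg ops c35 a₃ M i m := by
  intro α₀ U₀ hU₀ hα hMα hR
  obtain ⟨hlin, hherm⟩ := hstr α₀ U₀ hU₀ hα hMα hR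
  exact regularAtH_of_bondPair_pos τ hΩ hlin hherm fun A hA hA0 => hpos α₀ U₀ hU₀ hα hMα hR A hA hA0

/-- ★★★ **`InvAtH` FOR `withGopZdH ops` FROM `PosDefInClassAtH`** (finite `Ω₀`; linearity + Hermiticity preservation at the class): the composition for the per-member
Theorem 3.11 road on the Hermitian sub-carrier — (i)_𝔤 flat positivity, (ii) continuity, (iii) gauge covariance feed `PosDefInClassAtH`.
[cite: Balaban1985BackgroundPropagators, Thm 3.11 p.416, (3.27) p.395; Balaban1985RegularSpaces, (1.58) p.86] -/
theorem invAtH_withGopZdH_of_posDefH [FiniteDimensional ℝ 𝔸] (ops : ℝ → ZdIdx d L → ℕ → OpsZd d 𝔸) (c35 a₃ M : ℝ) (i : ZdIdx d L) (m : ℕ)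
    (hΩ : (i.Ω 0).Finite) (hstr : LinHermInClassAt bg mem ιCfg ops c35 a₃ M i m)
    (hpos : PosDefInClassAtH τ bg mem ιCfg ops c35 a₃ M i m) :
    InvAtH bg L mem ιCfg (withGopZdH ops) c35 a₃ M i m :=
  invAtH_withGopZdH ops M i m bg mem ιCfg c35 a₃ (regularInClassAtH_of_posDefH τ bg mem ιCfg ops c35 a₃ M i m hΩ hstr hpos)

end Positivity

end Literature.MathematicalPhysics.QuantumFieldTheory.Balaban1983to89.B9Eq327GreenZdHerm

end
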